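import Literature.NumberTheory.DiophantineGeometry.AVIsogenyTateOfCubeProofs
import HarnessLib

/-!
# Mumford §19, Theorem 3 and its corollaries: the discharges

`AVIsogenyTate` states, as named facts, Mumford's §19 Theorem 3 with its Corollaries 1–2 for abelian
varieties `A B : AbelianVariety K` over a field `K`: `Hom(A, B)` is finitely generated
(`AbelianVariety.module_finite_hom`) and free (`AbelianVariety.module_free_hom`), of rank
`≤ 4 dim A dim B` (`AbelianVariety.finrank_hom_le`), the Tate map
`ℤ_ℓ ⊗ Hom(A, B) → Hom_{Γ_K}(T_ℓ A, T_ℓ B)` is injective for `ℓ ≠ char K`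
(`AbelianVariety.faltingsTateMap_injective`), and `End⁰(A)` is finite-dimensional
(`AbelianVariety.finiteDimensional_endAlgebra`). The sibling proof files reduce all five to the
Theorem of the Cube (`theoremOfCube_linEquiv`, Görtz–Wedhorn II, Thm. 24.73) —
`AVIsogenyTateHomPositivityProofs` (finite generation over any field, via positive curve forms and
base change to `K̄`) and `AVIsogenyTateOfCubeProofs` (the four corollaries) — and
`Motives/AbelianVarietyTheoremOfCubeProofs` reduces the Theorem of the Cube to the single named fact
`cechComplex_pseudoCoherent_general` (Görtz–Wedhorn II, Thm. 23.133 / Cor. 23.135: pseudo-coherence of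
the Čech complex of `𝒪(D)`, i.e. the finiteness theorem for proper morphisms), which is now PROVED
(`cechComplex_pseudoCoherent_general_holds`, `Motives/CechComplexPseudoCoherentGeneralProofs`: Chow's
lemma, Serre's theorems, Leray in Čech form, rank-one dévissage, noetherian approximation), whence
the Theorem of the Cube itself (`theoremOfCube_linEquiv_holds`, `Motives/AbelianVarietyTheoremOfCubeProofs`).

This file records the resulting hypothesis-free discharges — closed statements, universally
quantified over the facts' own parameters `K`, `A`, `B` — each one application of a theorem of the
tree to `theoremOfCube_linEquiv_holds`:

* `AbelianVariety.module_finite_hom_holds` — §19 Thm. 3: `Hom(A, B)` is finitely generated;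
* `AbelianVariety.module_free_hom_holds` — §19 Thm. 3 with Cor. 1: `Hom(A, B)` is free;
* `AbelianVariety.faltingsTateMap_injective_holds` — §19 Thm. 3, second assertion;
* `AbelianVariety.finrank_hom_le_holds` — §19 Cor. 1: `rank Hom(A, B) ≤ 4 dim A dim B`;
* `AbelianVariety.finiteDimensional_endAlgebra_holds` — §19 Cor. 1–2: `dim_ℚ End⁰(A) < ∞`.

It lives in its own file because the proof files (`…OfCubeProofs` and its imports) themselves
import `AVIsogenyTate`, where the facts are declared.

## References

* [MumfordAV1970] D. Mumford, *Abelian Varieties*, TIFR Studies in Mathematics 5 (1970): §19,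
  Thm. 3 with Cor. 1–2 (pp. 176–178 of the 2nd ed.).
* [Milne1986AbelianVarieties] J. S. Milne, *Abelian Varieties*, in Cornell–Silverman (eds.),
  *Arithmetic Geometry* (1986): Thm. 12.5, Lemma 12.6, Cor. 12.8.
* [GortzWedhorn2023] U. Görtz, T. Wedhorn, *Algebraic Geometry II* (2023): Thm. 24.73 (p. 550);
  Thm. 23.133 / Cor. 23.135 (pp. 478–480); Thm. 23.17 / Cor. 23.18 (pp. 424–425).

## Design

No definitions, no named facts (net debt −5); one-line compositions of theorems in the tree.
Mathlib searched (pin): no abelian varieties, Tate modules or coherent cohomology in Mathlib.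
-/

universe u

noncomputable section

namespace Literature.NumberTheory.DiophantineGeometry

section AbelianVariety
open Literature.AlgebraicGeometry.Motives (AbelianVariety theoremOfCube_linEquiv_holds)
open Literature.AlgebraicGeometry.Motives.AbelianVariety

/-- **Mumford §19, Theorem 3: `Hom(A, B)` is a finitely generated abelian group**, for abelian
varieties `A`, `B` over any field `K` — the named fact `AbelianVariety.module_finite_hom` holds.
Proof: `module_finite_hom_of_theoremOfCube` (finite generation from the Theorem of the Cube, over `K̄`
by positive curve forms, descended along `Hom_K(A, B) ↪ Hom_{K̄}(A_{K̄}, B_{K̄})`) applied to the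
Theorem of the Cube `theoremOfCube_linEquiv_holds` (itself the proved finiteness theorem
`cechComplex_pseudoCoherent_general_holds` through `theoremOfCube_linEquiv_of_pseudoCoherent_general`).
[cite: MumfordAV1970, §19 Thm. 3] [cite: Milne1986AbelianVarieties, Thm. 12.5 (PDF pp. 190–192)] -/
theorem _root_.Literature.AlgebraicGeometry.Motives.AbelianVariety.module_finite_hom_holds :
    ∀ {K : Type u} [Field K] (A B : AbelianVariety K), module_finite_hom A B :=
  fun A B => module_finite_hom_of_theoremOfCube theoremOfCube_linEquiv_holds A B

/-- **Mumford §19, Theorem 3 with Corollary 1: `Hom(A, B)` is a free abelian group** — the named fact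
`AbelianVariety.module_free_hom` holds (`module_free_hom_of_theoremOfCube`: finitely generated and
torsion-free, `[n]_A` being an isogeny, hence free over the PID `ℤ`). [cite: MumfordAV1970, §19 Thm. 3 and Cor. 1] -/
theorem _root_.Literature.AlgebraicGeometry.Motives.AbelianVariety.module_free_hom_holds :
    ∀ {K : Type u} [Field K] (A B : AbelianVariety K), module_free_hom A B :=
  fun A B => module_free_hom_of_theoremOfCube theoremOfCube_linEquiv_holds A B

/-- **Mumford §19, Theorem 3, second assertion: for every prime `ℓ` invertible in `K` the Tate map
`ℤ_ℓ ⊗ Hom(A, B) → Hom_{Γ_K}(T_ℓ A, T_ℓ B)` is injective** — the named fact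
`AbelianVariety.faltingsTateMap_injective` holds (`faltingsTateMap_injective_of_theoremOfCube`;
Milne 1986, proof of Thm. 12.5 with Lemma 12.6).
[cite: MumfordAV1970, §19 Thm. 3] [cite: Milne1986AbelianVarieties, Thm. 12.5 with Lemma 12.6 (PDF pp. 190–192)] -/
theorem _root_.Literature.AlgebraicGeometry.Motives.AbelianVariety.faltingsTateMap_injective_holds :
    ∀ {K : Type u} [Field K] (A B : AbelianVariety K), faltingsTateMap_injective A B :=
  fun A B => faltingsTateMap_injective_of_theoremOfCube theoremOfCube_linEquiv_holds A B

/-- **Mumford §19, Corollary 1 of Theorem 3: `rank_ℤ Hom(A, B) ≤ 4 · dim A · dim B`** — the named fact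
`AbelianVariety.finrank_hom_le` holds (`finrank_hom_le_of_theoremOfCube`: finite generation,
injectivity of the Tate map and the torsion counts `#A[n](K̄) = n^{2 dim A}` from the cube).
[cite: MumfordAV1970, §19 Cor. 1 of Thm. 3] -/
theorem _root_.Literature.AlgebraicGeometry.Motives.AbelianVariety.finrank_hom_le_holds :
    ∀ {K : Type u} [Field K] (A B : AbelianVariety K), finrank_hom_le A B :=
  fun A B => finrank_hom_le_of_theoremOfCube theoremOfCube_linEquiv_holds A B

/-- **Mumford §19, Corollaries 1–2 of Theorem 3: `End⁰(A) = ℚ ⊗ End(A)` is a finite-dimensional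
`ℚ`-algebra** — the named fact `AbelianVariety.finiteDimensional_endAlgebra` holds
(`finiteDimensional_endAlgebra_of_theoremOfCube`). [cite: MumfordAV1970, §19 Cor. 1–2 of Thm. 3] -/
theorem _root_.Literature.AlgebraicGeometry.Motives.AbelianVariety.finiteDimensional_endAlgebra_holds :
    ∀ {K : Type u} [Field K] (A : AbelianVariety K), finiteDimensional_endAlgebra A :=
  fun A => finiteDimensional_endAlgebra_of_theoremOfCube theoremOfCube_linEquiv_holds A

end AbelianVariety

end Literature.NumberTheory.DiophantineGeometry
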